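import Literature.Geometry.Riemannian.MeanConvexSubharmonic
import Mathlib.Analysis.InnerProductSpace.Dual

/-!
# Tubes around submanifolds of codimension `≥ 2` are mean convex: the Hessian of `∑ᵢ Ψᵢ²`

Topic `Geometry/Riemannian` (fact seat
`provefact-Literature.Geometry.Riemannian.LawsonMichelsohn1984_surrounding`).  Everything here
is **proved**.

The handles of the surrounding construction (Lawson–Michelsohn 1984, §3) are thin tubes around
discs `Δ` of codimension `k ≥ 2` of `ℝ^{m+1}`.  Locally `Δ = {Ψ₁ = … = Ψ_k = 0}` for functions
with linearly independent differentials, and the tube is a sublevel set of `u = ∑ᵢ Ψᵢ²`.  At the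
points of `Δ`:

* `iteratedFDeriv_two_mul_apply_of_eq_zero`, `iteratedFDeriv_two_sum_sq_of_eq_zero` — Leibniz:
  `D²u(x)(a, b) = 2 ∑ᵢ dΨᵢ(x)(a) dΨᵢ(x)(b)` at a common zero `x`;
* `exists_forall_sum_sq_inner_le` — for a linearly independent family `g` with two distinct
  members, `sup_{‖w‖ = 1} ∑ᵢ ⟪gᵢ, w⟫² < ∑ᵢ ‖gᵢ‖²` (Cauchy–Schwarz with its equality case, on the
  compact unit sphere);
* `exists_trace_gt_of_sum_sq` — hence **`u` is strictly `m`-subharmonic at the points of `Δ`**: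
  `sup_{‖w‖=1} D²u(x)(w, w) < tr D²u(x)` (the hypothesis of `sum_iteratedFDeriv_two_pos_of_trace`,
  `MeanConvexSubharmonic.lean`), whatever `m`, as soon as `k ≥ 2`;
* `eventually_trace_gt` — the criterion `sup_{‖w‖=1} D²u(y)(w, w) < tr D²u(y)` is an open
  condition in `y` for `u` of class `C²` (so it holds on thin tubes around compact pieces of `Δ`).

Combined with `sum_iteratedFDeriv_two_pos_of_trace` this is the implicit-function form of "the
boundary of the `ε`-tube around a submanifold of codimension `≥ 2` has positive mean curvature for
small `ε`" (Lawson–Michelsohn 1984, §3; Gray, *Tubes*), with no curvature computation.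

## References

* H. B. Lawson, Jr., M.-L. Michelsohn, *Embedding and surrounding with positive mean curvature*,
  Invent. Math. 77 (1984), §3. [LawsonMichelsohn1984]
-/

noncomputable section

open Set Function Module Metric Filter
open scoped RealInnerProductSpace Topology

namespace Literature.Geometry.Riemannian

/-! ### Leibniz: second derivatives of products and of `∑ᵢ Ψᵢ²` at common zeros -/

section Leibniz

variable {E : Type*} [NormedAddCommGroup E] [NormedSpace ℝ E] {f g : E → ℝ} {x : E}

/-- **Leibniz at a zero**: for `f`, `g` of class `C²` at a zero `x` of `f`,
`D²(g f)(x)(u, v) = g(x) D²f(x)(u, v) + dg(x)(u) df(x)(v) + df(x)(u) dg(x)(v)` (the term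
`f(x) D²g(x)` vanishes). [folklore] -/
theorem iteratedFDeriv_two_mul_apply_of_eq_zero (hf : ContDiffAt ℝ 2 f x) (hg : ContDiffAt ℝ 2 g x)
    (hfx : f x = 0) (u v : E) :
    iteratedFDeriv ℝ 2 (fun y => g y * f y) x ![u, v] =
      g x * iteratedFDeriv ℝ 2 f x ![u, v] + fderiv ℝ g x u * fderiv ℝ f x v +
        fderiv ℝ f x u * fderiv ℝ g x v := by
  rw [iteratedFDeriv_two_apply, iteratedFDeriv_two_apply]
  simp only [Matrix.cons_val_zero, Matrix.cons_val_one]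
  have hf1 : ∀ᶠ y in 𝓝 x, DifferentiableAt ℝ f y :=
    (hf.eventually (by simp)).mono fun y hy => hy.differentiableAt (by simp)
  have hg1 : ∀ᶠ y in 𝓝 x, DifferentiableAt ℝ g y :=
    (hg.eventually (by simp)).mono fun y hy => hy.differentiableAt (by simp)
  have hdf : DifferentiableAt ℝ (fderiv ℝ f) x :=
    (hf.fderiv_right (m := 1) (by norm_num)).differentiableAt one_ne_zero
  have hdg : DifferentiableAt ℝ (fderiv ℝ g) x :=
    (hg.fderiv_right (m := 1) (by norm_num)).differentiableAt one_ne_zero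
  have hfd : DifferentiableAt ℝ f x := hf.differentiableAt (by simp)
  have hgd : DifferentiableAt ℝ g x := hg.differentiableAt (by simp)
  have hev : fderiv ℝ (fun y => g y * f y) =ᶠ[𝓝 x]
      fun y => g y • fderiv ℝ f y + f y • fderiv ℝ g y := by
    filter_upwards [hf1, hg1] with y hfy hgy
    rw [fderiv_fun_mul hgy hfy]
  rw [Filter.EventuallyEq.fderiv_eq hev]
  have h1 : HasFDerivAt (fun y => g y • fderiv ℝ f y)
      (g x • fderiv ℝ (fderiv ℝ f) x + (fderiv ℝ g x).smulRight (fderiv ℝ f x)) x :=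
    hgd.hasFDerivAt.smul hdf.hasFDerivAt
  have h2 : HasFDerivAt (fun y => f y • fderiv ℝ g y)
      (f x • fderiv ℝ (fderiv ℝ g) x + (fderiv ℝ f x).smulRight (fderiv ℝ g x)) x :=
    hfd.hasFDerivAt.smul hdg.hasFDerivAt
  rw [(h1.fun_add h2).fderiv]
  simp [hfx, ContinuousLinearMap.smulRight_apply]

/-- At a zero of `f` of class `C²`: `D²(f²)(x)(u, v) = 2 df(x)(u) df(x)(v)`. [folklore] -/
theorem iteratedFDeriv_two_sq_apply_of_eq_zero (hf : ContDiffAt ℝ 2 f x) (hfx : f x = 0) (u v : E) :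
    iteratedFDeriv ℝ 2 (fun y => f y ^ 2) x ![u, v] = 2 * (fderiv ℝ f x u * fderiv ℝ f x v) := by
  have h := iteratedFDeriv_two_mul_apply_of_eq_zero hf hf hfx u v
  simp only [hfx, zero_mul, zero_add] at h
  have heq : (fun y => f y ^ 2) = fun y => f y * f y := funext fun y => sq (f y)
  rw [heq, h]
  ring

/-- **The Hessian of `∑ᵢ Ψᵢ²` at a common zero**: `D²(∑ᵢ Ψᵢ²)(x)(u, v) = 2 ∑ᵢ dΨᵢ(u) dΨᵢ(v)`, for
finitely many functions `Ψᵢ` of class `C²` (globally) vanishing at `x`. [folklore] -/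
theorem iteratedFDeriv_two_sum_sq_of_eq_zero {ι : Type*} [Fintype ι] {Ψ : ι → E → ℝ}
    (hΨ : ∀ i, ContDiff ℝ 2 (Ψ i)) (h0 : ∀ i, Ψ i x = 0) (u v : E) :
    iteratedFDeriv ℝ 2 (fun y => ∑ i, Ψ i y ^ 2) x ![u, v] =
      2 * ∑ i, fderiv ℝ (Ψ i) x u * fderiv ℝ (Ψ i) x v := by
  classical
  have hsq : ∀ i, ContDiff ℝ 2 fun y => Ψ i y ^ 2 := fun i => (hΨ i).pow 2
  rw [iteratedFDeriv_sum (fun i _ => hsq i), Finset.mul_sum]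
  simp only [FunLike.coe_sum, Finset.sum_apply]
  exact Finset.sum_congr rfl fun i _ =>
    iteratedFDeriv_two_sq_apply_of_eq_zero (hΨ i).contDiffAt (h0 i) u v

end Leibniz

/-! ### Cauchy–Schwarz with a gap: `sup_{‖w‖=1} ∑ᵢ ⟪gᵢ, w⟫² < ∑ᵢ ‖gᵢ‖²` -/

section Gap

variable {E : Type*} [NormedAddCommGroup E] [InnerProductSpace ℝ E] [FiniteDimensional ℝ E]

/-- **Cauchy–Schwarz with a gap.**  For a linearly independent finite family `g` with two
distinct members there is `Λ < ∑ᵢ ‖gᵢ‖²` with `∑ᵢ ⟪gᵢ, w⟫² ≤ Λ` for all unit vectors `w` (the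
maximum over the compact unit sphere is attained, and equality in Cauchy–Schwarz for two members
would make both parallel to `w`). [folklore] -/
theorem exists_forall_sum_sq_inner_le {ι : Type*} [Fintype ι] {g : ι → E}
    (hg : LinearIndependent ℝ g) {i₀ j₀ : ι} (hij : i₀ ≠ j₀) :
    ∃ Λ : ℝ, (∀ w : E, ‖w‖ = 1 → ∑ i, ⟪g i, w⟫ ^ 2 ≤ Λ) ∧ Λ < ∑ i, ‖g i‖ ^ 2 := by
  classical
  have hgi : g i₀ ≠ 0 := hg.ne_zero i₀
  -- the unit sphere is compact and nonempty
  have hSc : IsCompact (sphere (0 : E) 1) := isCompact_sphere 0 1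
  have hSne : (sphere (0 : E) 1).Nonempty := ⟨‖g i₀‖⁻¹ • g i₀, by
    rw [mem_sphere_zero_iff_norm, norm_smul, norm_inv, norm_norm,
      inv_mul_cancel₀ (norm_ne_zero_iff.2 hgi)]⟩
  set φ : E → ℝ := fun w => ∑ i, ⟪g i, w⟫ ^ 2 with hφ
  have hφc : Continuous φ := by
    exact continuous_finsetSum _ fun i _ => (Continuous.inner continuous_const continuous_id).pow 2
  obtain ⟨w₀, hw₀, hmax⟩ := hSc.exists_isMaxOn hSne hφc.continuousOn
  have hw₀n : ‖w₀‖ = 1 := mem_sphere_zero_iff_norm.1 hw₀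
  refine ⟨φ w₀, fun w hw => hmax (mem_sphere_zero_iff_norm.2 hw), ?_⟩
  -- termwise Cauchy–Schwarz
  have hle : ∀ i, ⟪g i, w₀⟫ ^ 2 ≤ ‖g i‖ ^ 2 := fun i => by
    have h := abs_real_inner_le_norm (g i) w₀
    rw [hw₀n, mul_one] at h
    calc ⟪g i, w₀⟫ ^ 2 = |⟪g i, w₀⟫| ^ 2 := (sq_abs _).symm
      _ ≤ ‖g i‖ ^ 2 := by gcongr
  -- equality for `i` forces `g i ∥ w₀`
  have hpar : ∀ i, ⟪g i, w₀⟫ ^ 2 = ‖g i‖ ^ 2 → ∃ r : ℝ, g i = r • w₀ := by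
    intro i hi
    have hgi0 : g i ≠ 0 := hg.ne_zero i
    have hw₀0 : w₀ ≠ 0 := by
      rw [← norm_ne_zero_iff, hw₀n]; exact one_ne_zero
    have habs : |⟪g i, w₀⟫| = ‖g i‖ * ‖w₀‖ := by
      rw [hw₀n, mul_one]
      have h1 : |⟪g i, w₀⟫| ^ 2 = ‖g i‖ ^ 2 := by rw [sq_abs]; exact hi
      have := abs_nonneg ⟪g i, w₀⟫
      nlinarith [norm_nonneg (g i), sq_nonneg (|⟪g i, w₀⟫| - ‖g i‖), sq_nonneg (|⟪g i, w₀⟫| + ‖g i‖)]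
    have hone : |⟪g i, w₀⟫ / (‖g i‖ * ‖w₀‖)| = 1 := by
      rw [abs_div, habs, abs_of_pos (by positivity), div_self (by positivity)]
    obtain ⟨-, r, hr, hrw⟩ := (abs_real_inner_div_norm_mul_norm_eq_one_iff (g i) w₀).1 hone
    exact ⟨r⁻¹, by rw [hrw, smul_smul, inv_mul_cancel₀ hr, one_smul]⟩
  -- not both `i₀` and `j₀` can be parallel to `w₀`
  have hstrict : ⟪g i₀, w₀⟫ ^ 2 < ‖g i₀‖ ^ 2 ∨ ⟪g j₀, w₀⟫ ^ 2 < ‖g j₀‖ ^ 2 := by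
    by_contra h
    rw [not_or, not_lt, not_lt] at h
    obtain ⟨r, hr⟩ := hpar i₀ (le_antisymm (hle i₀) h.1)
    obtain ⟨r', hr'⟩ := hpar j₀ (le_antisymm (hle j₀) h.2)
    have hr0 : r ≠ 0 := fun h0 => hg.ne_zero i₀ (by rw [hr, h0, zero_smul])
    -- `g j₀ = (r'/r) • g i₀` contradicts linear independence
    have hmem : g j₀ ∈ Submodule.span ℝ (g '' {i₀}) := by
      rw [image_singleton, Submodule.mem_span_singleton]
      exact ⟨r' * r⁻¹, by rw [hr', hr, smul_smul, mul_assoc, inv_mul_cancel₀ hr0, mul_one]⟩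
    exact hg.notMem_span_image (s := {i₀}) (by simpa using hij.symm) hmem
  rcases hstrict with h | h
  · exact Finset.sum_lt_sum (fun i _ => hle i) ⟨i₀, Finset.mem_univ _, h⟩
  · exact Finset.sum_lt_sum (fun i _ => hle i) ⟨j₀, Finset.mem_univ _, h⟩

end Gap

/-! ### `∑ᵢ Ψᵢ²` is strictly `m`-subharmonic along `{Ψ = 0}` -/

section Tube

variable {E : Type*} [NormedAddCommGroup E] [InnerProductSpace ℝ E] [FiniteDimensional ℝ E]

/-- **Tubes of codimension `≥ 2` are mean convex, infinitesimal form.**  Let `Ψᵢ`, `i ∈ ι`, be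
`C²` functions vanishing at `x` whose differentials `dΨᵢ(x)` are linearly independent, with two
distinct indices `i₀ ≠ j₀` (codimension `≥ 2`).  Then `u = ∑ᵢ Ψᵢ²` satisfies, at `x`,
`sup_{‖w‖ = 1} D²u(x)(w, w) < tr D²u(x)`: there is `Λ` with `D²u(x)(w, w) ≤ Λ` for all unit `w` and
`Λ < ∑ⱼ D²u(x)(bⱼ, bⱼ)` for every orthonormal basis `b` — the hypothesis of
`sum_iteratedFDeriv_two_pos_of_trace`, so that every hyperplane section of `D²u(x)` has positive
trace (Lawson–Michelsohn 1984, §3: the `ε`-tube around a submanifold of codimension `q ≥ 2` has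
mean curvature `∼ (q - 1)/ε > 0`). [cite: LawsonMichelsohn1984, §3] -/
theorem exists_trace_gt_of_sum_sq {ι : Type*} [Fintype ι] {Ψ : ι → E → ℝ} {x : E}
    (hΨ : ∀ i, ContDiff ℝ 2 (Ψ i)) (h0 : ∀ i, Ψ i x = 0)
    (hind : LinearIndependent ℝ fun i => (fderiv ℝ (Ψ i) x : E →L[ℝ] ℝ)) {i₀ j₀ : ι}
    (hij : i₀ ≠ j₀) {κ : Type*} [Fintype κ] (b : OrthonormalBasis κ ℝ E) :
    ∃ Λ : ℝ, (∀ w : E, ‖w‖ = 1 → iteratedFDeriv ℝ 2 (fun y => ∑ i, Ψ i y ^ 2) x ![w, w] ≤ Λ) ∧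
      Λ < ∑ j, iteratedFDeriv ℝ 2 (fun y => ∑ i, Ψ i y ^ 2) x ![b j, b j] := by
  -- the gradients
  set g : ι → E := fun i => (InnerProductSpace.toDual ℝ E).symm (fderiv ℝ (Ψ i) x) with hg
  have hginner : ∀ i w, ⟪g i, w⟫ = fderiv ℝ (Ψ i) x w := fun i w => by
    rw [hg, InnerProductSpace.toDual_symm_apply]
  have hgind : LinearIndependent ℝ g := by
    have : g = (InnerProductSpace.toDual ℝ E).symm.toLinearEquiv ∘
        fun i => (fderiv ℝ (Ψ i) x : E →L[ℝ] ℝ) := rfl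
    rw [this]
    exact hind.map' _ (LinearEquiv.ker _)
  obtain ⟨Λ, hΛ, hlt⟩ := exists_forall_sum_sq_inner_le hgind hij
  have hD2 : ∀ u v, iteratedFDeriv ℝ 2 (fun y => ∑ i, Ψ i y ^ 2) x ![u, v] =
      2 * ∑ i, ⟪g i, u⟫ * ⟪g i, v⟫ := fun u v => by
    rw [iteratedFDeriv_two_sum_sq_of_eq_zero hΨ h0]
    simp only [hginner]
  refine ⟨2 * Λ, fun w hw => ?_, ?_⟩
  · rw [hD2]
    have := hΛ w hw
    have h' : ∑ i, ⟪g i, w⟫ * ⟪g i, w⟫ = ∑ i, ⟪g i, w⟫ ^ 2 :=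
      Finset.sum_congr rfl fun i _ => (sq _).symm
    rw [h']; linarith
  · simp_rw [hD2]
    rw [← Finset.mul_sum, Finset.sum_comm]
    have h' : ∑ i, ∑ j, ⟪g i, b j⟫ * ⟪g i, b j⟫ = ∑ i, ‖g i‖ ^ 2 :=
      Finset.sum_congr rfl fun i _ => by
        rw [← b.sum_sq_inner_left (g i)]
        exact Finset.sum_congr rfl fun j _ => (sq _).symm
    rw [h']; linarith

/-! ### The criterion is open -/

omit [FiniteDimensional ℝ E] in
/-- Second derivatives of a `C²` function depend continuously on the point, as bilinear forms:
near `y₀`, `|D²u(y)(a, c) - D²u(y₀)(a, c)| ≤ δ ‖a‖ ‖c‖`. [folklore] -/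
theorem eventually_abs_iteratedFDeriv_two_sub_le {u : E → ℝ} {y₀ : E} (hu : ContDiffAt ℝ 2 u y₀)
    {δ : ℝ} (hδ : 0 < δ) :
    ∀ᶠ y in 𝓝 y₀, ∀ a c : E,
      |iteratedFDeriv ℝ 2 u y ![a, c] - iteratedFDeriv ℝ 2 u y₀ ![a, c]| ≤ δ * ‖a‖ * ‖c‖ := by
  have h1 : ContDiffAt ℝ 1 (fderiv ℝ u) y₀ := hu.fderiv_right (m := 1) (by norm_num)
  have h0 : ContDiffAt ℝ 0 (fderiv ℝ (fderiv ℝ u)) y₀ := h1.fderiv_right (m := 0) (by norm_num)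
  have hc : ContinuousAt (fderiv ℝ (fderiv ℝ u)) y₀ := h0.continuousAt
  have hev : ∀ᶠ y in 𝓝 y₀, dist (fderiv ℝ (fderiv ℝ u) y) (fderiv ℝ (fderiv ℝ u) y₀) < δ :=
    Metric.tendsto_nhds.1 hc.tendsto δ hδ
  filter_upwards [hev] with y hy a c
  rw [iteratedFDeriv_two_vecCons, iteratedFDeriv_two_vecCons]
  have h := (fderiv ℝ (fderiv ℝ u) y - fderiv ℝ (fderiv ℝ u) y₀).le_opNorm₂ a c
  simp only [FunLike.coe_sub, Pi.sub_apply, Real.norm_eq_abs] at h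
  refine h.trans ?_
  have : ‖fderiv ℝ (fderiv ℝ u) y - fderiv ℝ (fderiv ℝ u) y₀‖ ≤ δ :=
    (dist_eq_norm (fderiv ℝ (fderiv ℝ u) y) (fderiv ℝ (fderiv ℝ u) y₀)).symm.trans_le hy.le
  gcongr

omit [FiniteDimensional ℝ E] in
/-- **The `m`-subharmonic criterion is an open condition**: if `u` is `C²` at `y₀` and
`sup_{‖w‖=1} D²u(y₀)(w, w) < tr D²u(y₀)` (witnessed by `Λ`), then the same holds at all `y` near `y₀`
(with the orthonormal basis `b` fixed). [folklore] -/
theorem eventually_trace_gt {u : E → ℝ} {y₀ : E} (hu : ContDiffAt ℝ 2 u y₀)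
    {κ : Type*} [Fintype κ] (b : OrthonormalBasis κ ℝ E) {Λ : ℝ}
    (hΛ : ∀ w : E, ‖w‖ = 1 → iteratedFDeriv ℝ 2 u y₀ ![w, w] ≤ Λ)
    (hlt : Λ < ∑ j, iteratedFDeriv ℝ 2 u y₀ ![b j, b j]) :
    ∀ᶠ y in 𝓝 y₀, ∃ Λ' : ℝ, (∀ w : E, ‖w‖ = 1 → iteratedFDeriv ℝ 2 u y ![w, w] ≤ Λ') ∧
      Λ' < ∑ j, iteratedFDeriv ℝ 2 u y ![b j, b j] := by
  set μ : ℝ := ∑ j, iteratedFDeriv ℝ 2 u y₀ ![b j, b j] - Λ with hμ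
  have hμpos : 0 < μ := by rw [hμ]; linarith
  set δ : ℝ := μ / (2 * (Fintype.card κ + 2)) with hδ
  have hδpos : 0 < δ := by positivity
  filter_upwards [eventually_abs_iteratedFDeriv_two_sub_le hu hδpos] with y hy
  refine ⟨Λ + δ, fun w hw => ?_, ?_⟩
  · have h := hy w w
    rw [hw, mul_one, mul_one] at h
    have h' := hΛ w hw
    linarith [(abs_le.1 h).2]
  · have hterm : ∀ j, iteratedFDeriv ℝ 2 u y₀ ![b j, b j] - δ ≤ iteratedFDeriv ℝ 2 u y ![b j, b j] := by
      intro j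
      have h := hy (b j) (b j)
      rw [b.orthonormal.1 j, mul_one, mul_one] at h
      linarith [(abs_le.1 h).1]
    have hsum : ∑ j, (iteratedFDeriv ℝ 2 u y₀ ![b j, b j] - δ) ≤ ∑ j, iteratedFDeriv ℝ 2 u y ![b j, b j] :=
      Finset.sum_le_sum fun j _ => hterm j
    rw [Finset.sum_sub_distrib, Finset.sum_const, Finset.card_univ, nsmul_eq_mul] at hsum
    have hcard : (0 : ℝ) ≤ Fintype.card κ := by positivity
    have hδμ : δ * (Fintype.card κ + 2) = μ / 2 := by
      rw [hδ]; field_simp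
    nlinarith [hsum, hδμ, hμpos]

end Tube

end Literature.Geometry.Riemannian

end
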